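import Summits.HubbardSuperconductivity.HubbardLadder.R3R4SoundLinAlg
import HarnessLib

/-!
# Rung R3 — soundness of the ED-enclosure certificate, part 2/4: the window certificate (§2–§4)

HONEST FRAMING (page 1): ladder R1–R4 with certified numbers; no claim on H/H₀.
(The r3 seat's `R3R4Sound` split into four files for the 400-line limit, statements unchanged:
`R3R4SoundLinAlg` = §1, `R3R4SoundWindow` = §2–§4, `R3R4SoundMultiplet` = §5, `R3R4Sound` = §6 +
the overview docstring; import `R3R4Sound` to get everything. The `ℓ²` norm is the tree's
`Literature.MathematicalPhysics.QuantumLattice.eucNorm` (`ApproximateEigenvectorLemmas`) and the observable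
enclosure is a corollary of `GroundStateEnclosure.norm_expect_sub_expect_le`; the Davis–Kahan bound here,
`eucNorm_sub_proj_le_of_complement_gap`, is the variant of `GroundStateEnclosure.eucNorm_sub_proj_le_of_residual`
with the gap hypothesis on the TRIAL vector's complement inside a sector and the conclusion for every sector
ground state, which is the shape a certificate producer supplies.)

§2: the correlator `O_r = Σ_x P_x† P_{x+r}` is bounded by `L² C_d²`; §3: the ED-enclosure certificate
`ResidualComplementData` and its soundness `ResidualComplementData.toWindow : PairCorrWindowCert` (tree,
`R3R4Props`), with `complement_of_shifted_lower_bound` (§1) supplying the hard input `β` as a PSD statement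
`H + c φφ† - β ⪰ 0` on the sector; §4: the ground-state positivity block `⟨ψ, a†[H, a] ψ⟩ ≥ 0` (R4-MEMO M3).
No certificate exists; these are soundness edges.
-/

namespace Summit.HubbardSuperconductivity.HubbardLadder

open Matrix Finset Filter Literature.Probability.LatticeModels
  Literature.MathematicalPhysics.QuantumLattice
open scoped ComplexOrder Topology InnerProductSpace

noncomputable section

/-! ## §2 The correlator `O_r = Σ_x P_x† P_{x+r}` is bounded by `L² C_d²` -/

section PairCorrOperator

variable (L : ℕ) [NeZero L]

/-- The (non-Hermitian) operator whose expectation's real part, divided by `L²`, is `avgPairCorr`: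
`O_r = Σ_x P_x† P_{x+r}`. [cite: QinEtAl2020, §II eqs. (2)–(4)] -/
def pairCorrOp (r : Site 2) :
    Matrix (Finset (Orb (FermionTorus 2 L))) (Finset (Orb (FermionTorus 2 L))) ℂ :=
  ∑ x : TorusSite 2 L, (localPair dWaveFormFactor L x)ᴴ *
    localPair dWaveFormFactor L (x + Torus.proj L r)

/-- The tree's local-pair norm constant `C_d = Σ_{e ∈ {0} ∪ unitSteps} 2‖g e / √2‖` for the
`d`-wave form factor. [folklore] -/
def dWaveLocalPairNormConst : ℝ :=
  ∑ e ∈ insert 0 unitSteps, ‖((dWaveFormFactor e / Real.sqrt 2 : ℝ) : ℂ)‖ * 2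

/-- `0 ≤ C_d`. [folklore] -/
theorem dWaveLocalPairNormConst_nonneg : 0 ≤ dWaveLocalPairNormConst :=
  localPairNormBound_nonneg dWaveFormFactor

/-- `|⟨u, O_r v⟩| ≤ L² C_d² ‖u‖ ‖v‖` (each term is `⟨P_x u, P_{x+r} v⟩`, Cauchy–Schwarz and the
contraction bound `‖P_x u‖ ≤ C_d ‖u‖`, `norm_toLp_localPair_mulVec_le`). [folklore] -/
theorem norm_star_dotProduct_pairCorrOp_le (r : Site 2) (u v : Fock (Orb (FermionTorus 2 L))) :
    ‖star u ⬝ᵥ pairCorrOp L r *ᵥ v‖ ≤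
      ((L : ℝ) ^ 2 * dWaveLocalPairNormConst ^ 2) * eucNorm u * eucNorm v := by
  unfold pairCorrOp
  rw [sum_mulVec, dotProduct_sum]
  refine (norm_sum_le _ _).trans ?_
  have hterm : ∀ x : TorusSite 2 L,
      ‖star u ⬝ᵥ ((localPair dWaveFormFactor L x)ᴴ *
          localPair dWaveFormFactor L (x + Torus.proj L r)) *ᵥ v‖ ≤
        dWaveLocalPairNormConst ^ 2 * eucNorm u * eucNorm v := by
    intro x
    rw [← mulVec_mulVec, Matrix.dotProduct_mulVec, ← Matrix.star_mulVec]
    refine (norm_star_dotProduct_le _ _).trans ?_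
    have hu := norm_toLp_localPair_mulVec_le dWaveFormFactor L x u
    have hv := norm_toLp_localPair_mulVec_le dWaveFormFactor L (x + Torus.proj L r) v
    calc eucNorm (localPair dWaveFormFactor L x *ᵥ u) *
          eucNorm (localPair dWaveFormFactor L (x + Torus.proj L r) *ᵥ v)
        ≤ (dWaveLocalPairNormConst * eucNorm u) * (dWaveLocalPairNormConst * eucNorm v) :=
          mul_le_mul hu hv (eucNorm_nonneg _)
            (mul_nonneg dWaveLocalPairNormConst_nonneg (eucNorm_nonneg _))
      _ = dWaveLocalPairNormConst ^ 2 * eucNorm u * eucNorm v := by ring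
  refine (Finset.sum_le_sum fun x _ => hterm x).trans ?_
  simp only [Finset.sum_const, Finset.card_univ, Fintype.card_pi, ZMod.card, Finset.prod_const,
    Fintype.card_fin, nsmul_eq_mul]
  push_cast
  nlinarith [sq_nonneg (L : ℝ), dWaveLocalPairNormConst_nonneg, eucNorm_nonneg u, eucNorm_nonneg v,
    mul_nonneg (mul_nonneg (sq_nonneg dWaveLocalPairNormConst) (eucNorm_nonneg u)) (eucNorm_nonneg v)]

/-- `avgPairCorr` is `L⁻² re ⟨ψ, O_r ψ⟩`. [cite: QinEtAl2020, §II eqs. (2)–(4)] -/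
theorem avgPairCorr_eq_re_expect_pairCorrOp (m : ℕ) (r : Site 2)
    (ψ : Fock (Orb (FermionTorus 2 (m + 1)))) :
    avgPairCorr (m + 1) r ψ =
      (star ψ ⬝ᵥ pairCorrOp (m + 1) r *ᵥ ψ).re / ((m + 1 : ℕ) : ℝ) ^ 2 := by
  show (∑ x : TorusSite 2 (m + 1), (expect ((localPair dWaveFormFactor (m + 1) x)ᴴ *
      localPair dWaveFormFactor (m + 1) (x + Torus.proj (m + 1) r)) ψ).re) /
        ((m + 1 : ℕ) : ℝ) ^ 2 = _
  rw [pairCorrOp, ← Complex.re_sum, ← expect_sum]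
  rfl

end PairCorrOperator

/-! ## §3 The ED-enclosure certificate and its soundness (`PairCorrWindowCert.ofResidual`) -/

/-- **R3-0-ED certificate data** at `(H, N, L, r)`: an explicit approximate sector ground state `φ`
with certified residual, Rayleigh value, complement gap and correlator enclosure. The field
`complement` (a certified lower bound `β > ρ` on `H L` over the unit vectors of the sector orthogonal
to `φ`) is the hard input — it is a second-eigenvalue statement and fails honestly when the sector
ground state is degenerate. [folklore] -/
structure ResidualComplementData (H : TorusHamiltonianFamily) (N : ℕ → ℕ) (L : ℕ) (r : Site 2) where
  /-- the certified approximate ground state (explicit vector) -/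
  φ : Fock (Orb (FermionTorus 2 L))
  /-- the shift used in the residual (any scalar; the Rayleigh value is optimal) -/
  σ : ℂ
  /-- certified upper bound on `re ⟨φ, H φ⟩` -/
  ρ : ℝ
  /-- certified residual bound -/
  ε : ℝ
  /-- certified complement Rayleigh lower bound -/
  β : ℝ
  /-- certified enclosure of `P̄_d(L, r; φ)` -/
  clo : ℝ
  chi : ℝ
  herm : (H L).IsHermitian
  mem : φ ∈ szSector (Λ := FermionTorus 2 L) (N L) 0
  unit : star φ ⬝ᵥ φ = 1
  rayleigh_le : (star φ ⬝ᵥ (H L) *ᵥ φ).re ≤ ρ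
  residual_le : eucNorm ((H L) *ᵥ φ - σ • φ) ≤ ε
  gap : ρ < β
  complement : ∀ v ∈ szSector (Λ := FermionTorus 2 L) (N L) 0, star φ ⬝ᵥ v = 0 →
    star v ⬝ᵥ v = 1 → β ≤ (star v ⬝ᵥ (H L) *ᵥ v).re
  value_mem : clo ≤ avgPairCorr L r φ ∧ avgPairCorr L r φ ≤ chi

namespace ResidualComplementData

variable {H : TorusHamiltonianFamily} {N : ℕ → ℕ} {L : ℕ} {r : Site 2}

/-- The eigenvector-enclosure radius `δ = ε / (β - ρ)`. [folklore] -/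
def δ (d : ResidualComplementData H N L r) : ℝ := d.ε / (d.β - d.ρ)

/-- The correlator slack `2 C_d² (δ + δ²)`. [folklore] -/
def slack (d : ResidualComplementData H N L r) : ℝ :=
  2 * dWaveLocalPairNormConst ^ 2 * (d.δ + d.δ ^ 2)

/-- **Soundness of the R3-0-ED certificate (proved).** Every normalised sector ground state `ψ` has
`|P̄_d(L, r; ψ) - P̄_d(L, r; φ)| ≤ 2 C_d² (δ + δ²)`. [folklore] -/
theorem abs_avgPairCorr_sub_le (d : ResidualComplementData H N L r)
    (ψ : Fock (Orb (FermionTorus 2 L))) (hψ : star ψ ⬝ᵥ ψ = 1)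
    (hgs : IsGroundStateInSector (H L) (N L) 0 ψ) :
    |avgPairCorr L r ψ - avgPairCorr L r d.φ| ≤ d.slack := by
  have hδ := eucNorm_sub_proj_le_of_complement_gap d.herm (szSector (N L) 0) d.mem d.unit d.rayleigh_le
    d.residual_le d.gap d.complement hgs.1 hψ hgs.2.2
  cases L with
  | zero =>
    simp only [avgPairCorr, sub_self, abs_zero, slack]
    have h0 : 0 ≤ d.δ := (eucNorm_nonneg _).trans hδ
    have := dWaveLocalPairNormConst_nonneg
    positivity
  | succ m =>
    rw [avgPairCorr_eq_re_expect_pairCorrOp, avgPairCorr_eq_re_expect_pairCorrOp, ← sub_div,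
      abs_div, abs_of_pos (by positivity : (0 : ℝ) < ((m + 1 : ℕ) : ℝ) ^ 2),
      div_le_iff₀ (by positivity)]
    refine (abs_re_expect_sub_le_of_proj (norm_star_dotProduct_pairCorrOp_le (m + 1) r)
      d.unit hψ hδ).trans (le_of_eq ?_)
    simp only [slack, δ]
    push_cast
    ring

/-- **`PairCorrWindowCert.ofResidual`**: the ED-enclosure certificate yields an R3 window row with
`lo = c⁻ - slack`, `hi = c⁺ + slack`. [folklore] -/
def toWindow (d : ResidualComplementData H N L r) : PairCorrWindowCert H N L r where
  lo := d.clo - d.slack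
  hi := d.chi + d.slack
  sound ψ hψ hgs := by
    have h := abs_le.1 (d.abs_avgPairCorr_sub_le ψ hψ hgs)
    constructor <;> linarith [d.value_mem.1, d.value_mem.2, h.1, h.2]

end ResidualComplementData

/-! ## §4 The ground-state positivity block (R4-MEMO M3) -/

/-- **Ground-state positivity (proved).** For Hermitian `A`, a sector `K`, a unit sector ground
EIGENstate `ψ` (`A ψ = E_K ψ`) and any operator `a` mapping `ψ` into `K`:
`0 ≤ re ⟨ψ, a† (A a - a A) ψ⟩` (`= ⟨aψ, (A - E_K) aψ⟩ ≥ 0` by the sector variational bound). This is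
the PSD block `ω(b_i† [H, b_j]) ⪰ 0` of ground-state relaxations, valid for sector ground states and
sector-preserving words. [cite: FawziFawziScalet2024, §2] -/
theorem re_expect_conjTranspose_commutator_nonneg {n : Type*} [Fintype n] [DecidableEq n]
    {A a : Matrix n n ℂ} (hA : A.IsHermitian) (K : Submodule ℂ (n → ℂ)) {ψ : n → ℂ}
    (haψ : a *ᵥ ψ ∈ K) (heig : A *ᵥ ψ = ((A.minEnergyOn K : ℝ) : ℂ) • ψ) :
    0 ≤ (star ψ ⬝ᵥ (aᴴ * (A * a - a * A)) *ᵥ ψ).re := by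
  have hform : star ψ ⬝ᵥ (aᴴ * (A * a - a * A)) *ᵥ ψ =
      star (a *ᵥ ψ) ⬝ᵥ A *ᵥ (a *ᵥ ψ) -
        ((A.minEnergyOn K : ℝ) : ℂ) * (star (a *ᵥ ψ) ⬝ᵥ (a *ᵥ ψ)) := by
    rw [← mulVec_mulVec, Matrix.dotProduct_mulVec (star ψ) aᴴ, ← Matrix.star_mulVec,
      Matrix.sub_mulVec, ← mulVec_mulVec, ← mulVec_mulVec, heig, mulVec_smul, dotProduct_sub,
      dotProduct_smul, smul_eq_mul]
  rw [hform, Complex.sub_re, Complex.re_ofReal_mul, ← eucNorm_sq, sub_nonneg]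
  exact mul_eucNorm_sq_le_of_unit_bound fun c _ hunit =>
    minEnergyOn_le_rayleigh_of_mem hA K (K.smul_mem _ haψ) hunit

/-- **Ground-state positivity on the Hubbard tori (proved)**: for the sector ground states that the
certificates quantify over (`IsGroundStateInSector (H L) (N L) 0 ψ`), every operator `a` with
`a ψ ∈ szSector (N L) 0` (e.g. a word preserving particle number and `S^z`) satisfies
`0 ≤ re ⟨ψ, a† (H a - a H) ψ⟩`. [cite: FawziFawziScalet2024, §2] -/
theorem gsPositivity {H : TorusHamiltonianFamily} {N : ℕ → ℕ} {L : ℕ} (hH : (H L).IsHermitian)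
    {a : Matrix (Finset (Orb (FermionTorus 2 L))) (Finset (Orb (FermionTorus 2 L))) ℂ}
    {ψ : Fock (Orb (FermionTorus 2 L))} (hgs : IsGroundStateInSector (H L) (N L) 0 ψ)
    (ha : a *ᵥ ψ ∈ szSector (Λ := FermionTorus 2 L) (N L) 0) :
    0 ≤ (star ψ ⬝ᵥ (aᴴ * (H L * a - a * H L)) *ᵥ ψ).re :=
  re_expect_conjTranspose_commutator_nonneg hH (szSector (N L) 0) ha hgs.2.2

end

end Summit.HubbardSuperconductivity.HubbardLadder
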